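import Summits.CriticalPhenomena.PercolationContinuityZ3.Theorems.Transplant.GrigorchukPowerReturnDecayUniform
import Mathlib.Analysis.SpecificLimits.Normed
import Mathlib.Analysis.SpecialFunctions.Pow.Asymptotics
import Mathlib.Analysis.PSeries
import HarnessLib

/-!
# W4 stub `stub_uniformPolygons` DISCHARGED modulo Woess 2000 Cor. 14.5(b): the lazy random-walk polygons of `Cay(𝔊^k; std)` are bounded UNIFORMLY in `k`,
# for every `q` (item E4.2, file b)

Proof file (`--supports stmt-CriticalPhenomena-4575 --as helper`), lane `prim-bschramm`, seat `prim-bschramm-gen-1` gen 12 (GEN pen); item E4.2 of the lead's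
allocation (lead g29, bus 2026-08-29 #9731/#9784; W4 skeleton of record v1.1 98f98c28, stub `stub_uniformPolygons : UniformPolygons`, binder form b1
`UniformPolygons (q)` of DEFS-A p704571), FILE b over FILE a «GrigorchukPowerReturnDecayUniform» (`lazyStep_eq_sum_choose`, `simpleStep_gkCay_self_le_exp`).
builds on p205010 (kernel theorem, internal audit signed; external expert review pending) — nothing here uses p205010.  Def-free; no instance, no notation, no sorry,
no `@[conjecture]`.  NOTHING here claims `θ(p_c) = 0`, an infrared bound or the triangle condition on any `Cay(𝔊^k)`; the ONLY print input is the Woess named fact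
`Woess2000_closedWalks_decay_of_growth` (p687849), a hypothesis of the last theorem — the result is CONDITIONAL on it and says so.

THE ARGUMENT.  (§1) Binomial bookkeeping: `C(n+r, r)·C(n, j) = C(j+r, j)·C(n+r, j+r)` (`choose_mul_choose_eq`, Mathlib `Nat.choose_mul` twice) and the negative-binomial
series at `1/2` give the RESUMMATION **`Σ_{m} C(m+j+r, r) C(m+j, j) 2^{−(m+j)} = 2^{r+1} C(j+r, j)`** (`tsum_weight_eq`) — the lazy weights, summed over the time at which
`j` genuine steps have been made, are the SIMPLE-walk polygon weights times `2^q` (`𝒢_L = 2𝒢 ⇒ 𝒢_L^q = 2^q 𝒢^q`).  (§2) Hence, for any locally finite graph and any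
pointwise bound `p_j(v,v) ≤ b_j` on the simple walk's return probabilities, **`rwPolygon (r+1) G v = ofReal(2^{r+1}) · Σ'_j ofReal(C(j+r, j) · p_j(v,v))`**
(`rwPolygon_succ_eq`, Fubini in `ℝ≥0∞`) and so `≤ ofReal(2^{r+1}) · Σ'_j ofReal(C(j+r, j) · b_j)` (`rwPolygon_succ_le_of_simpleStep_le`); `rwPolygon 0 = rwPolygon 1`
(the ℕ-subtraction quirk of the skeleton's definition).  (§3) `j ↦ C(j+r, j)·exp(−c j^γ)` is summable for `c, γ > 0` (`summable_choose_mul_exp_neg_rpow`: powers are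
`o(exp)` in the variable `u = j^γ`, comparison with `Σ 1/j²`).  (§4) With FILE a's `k`-UNIFORM decay `p^{(k)}_j(v,v) ≤ exp(−c j^γ)` (Woess on the base ONCE, product
formula): **`uniformPolygons_of_woess (hW) (q) : UniformPolygons q`** with the explicit `k`-free bound `ofReal(2^{r+1})·ofReal(Σ_j C(j+r, j) e^{−c j^γ}) < ⊤`
(`q = r+1`; `q = 0` via `rwPolygon 0 = rwPolygon 1`) — the W4 skeleton's `stub_uniformPolygons` in the b1 reading `∀ q, UniformPolygons q`, CONDITIONAL on `hW`.
[cite: Woess2000, §1.B, Cor. 14.5(b), Thm. 4.18] [cite: HeydenreichVanDerHofstad2017, §5.2 (random-walk diagrams)] [cite: BenjaminiSchramm1996, §2 (Cayley graphs)]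
-/

noncomputable section

namespace Summit.CriticalPhenomena.PercolationContinuityZ3.Theorems.Transplant

namespace Grigorchuk

namespace NcHaraSlade

open SimpleGraph Finset Filter Asymptotics Literature.Probability.MarkovChains Literature.Barriers.CriticalPhenomena
open scoped ENNReal Classical Topology

/-! ## §1 Binomial bookkeeping: the lazy weights resum to the simple weights times `2^q` -/

/-- `C(n+r, r)·C(n, j) = C(j+r, j)·C(n+r, j+r)` for `j ≤ n` (both equal `(n+r)!/(r!·j!·(n−j)!)`; Mathlib's `Nat.choose_mul` twice). [folklore] -/
theorem choose_mul_choose_eq (n r j : ℕ) (hj : j ≤ n) :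
    (n + r).choose r * n.choose j = (j + r).choose j * (n + r).choose (j + r) := by
  have h1 : (n + r).choose n * n.choose j = (n + r).choose j * (n + r - j).choose (n - j) :=
    Nat.choose_mul hj
  have h2 : (n + r).choose (j + r) * (j + r).choose j = (n + r).choose j * (n + r - j).choose (j + r - j) :=
    Nat.choose_mul (Nat.le_add_right j r)
  have h3 : (n + r).choose n = (n + r).choose r := Nat.choose_symm_add
  have h4 : (n + r - j).choose (n - j) = (n + r - j).choose r := by
    rw [show n + r - j = (n - j) + r by omega]; exact Nat.choose_symm_add
  rw [Nat.add_sub_cancel_left] at h2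
  rw [← h3, h1, h4, ← h2, mul_comm]

/-- **The resummation of the lazy weights**: `Σ_m C(m+j+r, r)·C(m+j, j)·2^{−(m+j)} = 2^{r+1}·C(j+r, j)` (negative-binomial series at `1/2`: the lazy walk spends a
`NegBin` number of idle steps between genuine ones; `𝒢_L^{r+1} = 2^{r+1} 𝒢^{r+1}`), with the summability of the summand. [cite: HeydenreichVanDerHofstad2017, §5.2] -/
theorem tsum_weight_eq (r j : ℕ) :
    (Summable fun m : ℕ => (((m + j + r).choose r : ℕ) : ℝ) * (((m + j).choose j : ℕ) : ℝ) / 2 ^ (m + j)) ∧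
    ∑' m : ℕ, (((m + j + r).choose r : ℕ) : ℝ) * (((m + j).choose j : ℕ) : ℝ) / 2 ^ (m + j) = 2 ^ (r + 1) * (((j + r).choose j : ℕ) : ℝ) := by
  have hhalf : ‖(1 / 2 : ℝ)‖ < 1 := by rw [Real.norm_of_nonneg (by norm_num)]; norm_num
  -- termwise: `C(m+j+r, r) C(m+j, j) / 2^(m+j) = C(j+r, j) (1/2)^j · C(m + (j+r), j+r) (1/2)^m`
  have hterm : ∀ m : ℕ, (((m + j + r).choose r : ℕ) : ℝ) * (((m + j).choose j : ℕ) : ℝ) / 2 ^ (m + j) =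
      (((j + r).choose j : ℕ) : ℝ) * (1 / 2) ^ j * ((((m + (j + r)).choose (j + r) : ℕ) : ℝ) * (1 / 2) ^ m) := by
    intro m
    have h := choose_mul_choose_eq (m + j) r j (Nat.le_add_left j m)
    have h' : (((m + j + r).choose r : ℕ) : ℝ) * (((m + j).choose j : ℕ) : ℝ) =
        (((j + r).choose j : ℕ) : ℝ) * (((m + (j + r)).choose (j + r) : ℕ) : ℝ) := by
      rw [← Nat.cast_mul, h, Nat.cast_mul, add_assoc]
    rw [h', pow_add, one_div, inv_pow, inv_pow]
    field_simp
  have hgeo := hasSum_choose_mul_geometric_of_norm_lt_one (j + r) hhalf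
  have hsum : HasSum (fun m : ℕ => (((m + j + r).choose r : ℕ) : ℝ) * (((m + j).choose j : ℕ) : ℝ) / 2 ^ (m + j))
      ((((j + r).choose j : ℕ) : ℝ) * (1 / 2) ^ j * (1 / (1 - 1 / 2) ^ (j + r + 1))) := by
    simp_rw [hterm]
    exact hgeo.mul_left _
  refine ⟨hsum.summable, ?_⟩
  rw [hsum.tsum_eq]
  have e : (1 : ℝ) / (1 - 1 / 2) ^ (j + r + 1) = 2 ^ (j + r + 1) := by
    rw [show (1 : ℝ) - 1 / 2 = 2⁻¹ by norm_num, inv_pow, one_div, inv_inv]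
  rw [e, pow_add, pow_add, one_div, inv_pow]
  field_simp
  ring

/-! ## §2 The lazy polygon in terms of the simple walk's return probabilities -/

/-- `0 ≤ p_n(x, y)` for the simple-walk kernel of DEFS-A (an average of nonnegative numbers). [folklore] -/
theorem simpleStep_nonneg {V : Type} (G : SimpleGraph V) [G.LocallyFinite] (n : ℕ) (x y : V) : 0 ≤ simpleStep G n x y := by
  induction n generalizing x with
  | zero => rw [simpleStep_zero]; split_ifs <;> norm_num
  | succ n ih => rw [simpleStep_succ]; exact Finset.sum_nonneg fun z _ => mul_nonneg (by positivity) (ih z)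

/-- **The ℕ-subtraction quirk of `rwPolygon`**: `rwPolygon 0 G v = rwPolygon 1 G v` (both weights are `C(·, 0) = 1`). [folklore] -/
theorem rwPolygon_zero_eq_one {V : Type} (G : SimpleGraph V) [G.LocallyFinite] (v : V) : rwPolygon 0 G v = rwPolygon 1 G v := by
  unfold rwPolygon
  refine tsum_congr fun n => ?_
  simp

/-- **THE LAZY POLYGON IS `2^q` TIMES THE SIMPLE POLYGON**: `rwPolygon (r+1) G v = ofReal(2^{r+1}) · Σ'_j ofReal(C(j+r, j)·p_j(v, v))` for every locally finite graph —
`lazyStep_eq_sum_choose` (FILE a), Fubini in `ℝ≥0∞`, the shift `n = m + j`, and the resummation `tsum_weight_eq`. [cite: HeydenreichVanDerHofstad2017, §5.2 (random-walk diagrams)] -/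
theorem rwPolygon_succ_eq {V : Type} (G : SimpleGraph V) [G.LocallyFinite] (v : V) (r : ℕ) :
    rwPolygon (r + 1) G v = ENNReal.ofReal (2 ^ (r + 1)) * ∑' j : ℕ, ENNReal.ofReal ((((j + r).choose j : ℕ) : ℝ) * simpleStep G j v v) := by
  unfold rwPolygon
  have hq : ∀ n : ℕ, (Nat.choose (n + (r + 1) - 1) (r + 1 - 1) : ℝ) = (((n + r).choose r : ℕ) : ℝ) := fun n => by
    rw [← Nat.add_assoc, Nat.add_sub_cancel, Nat.add_sub_cancel]
  -- the double family `g n j = C(n+r, r) C(n, j) 2^{-n} p_j ≥ 0`, vanishing for `j > n`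
  set g : ℕ → ℕ → ℝ≥0∞ := fun n j =>
    ENNReal.ofReal ((((n + r).choose r : ℕ) : ℝ) * ((((n.choose j : ℕ) : ℝ)) / 2 ^ n * simpleStep G j v v)) with hg
  have hp0 : ∀ j, 0 ≤ simpleStep G j v v := fun j => simpleStep_nonneg G j v v
  -- step 1: each lazy term is the finite sum `Σ_{j ≤ n} g n j = Σ'_j g n j`
  have h1 : ∀ n : ℕ, ENNReal.ofReal ((Nat.choose (n + (r + 1) - 1) (r + 1 - 1) : ℝ) * lazyStep G n v v) = ∑' j : ℕ, g n j := by
    intro n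
    rw [hq, lazyStep_eq_sum_choose, Finset.mul_sum,
      ENNReal.ofReal_sum_of_nonneg (fun j _ => mul_nonneg (Nat.cast_nonneg _) (mul_nonneg (by positivity) (hp0 j)))]
    rw [tsum_eq_sum (s := Finset.range (n + 1)) (fun j hj => ?_)]
    rw [Finset.mem_range, not_lt] at hj
    simp only [hg, Nat.choose_eq_zero_of_lt (Nat.lt_of_succ_le hj), Nat.cast_zero, zero_div, zero_mul, mul_zero, ENNReal.ofReal_zero]
  rw [tsum_congr h1, ENNReal.tsum_comm, ← ENNReal.tsum_mul_left]
  refine tsum_congr fun j => ?_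
  -- step 2: the shift `n = m + j` (the terms `n < j` vanish)
  have hzero : ∀ i ∈ Finset.range j, g i j = 0 := fun i hi => by
    simp only [hg, Nat.choose_eq_zero_of_lt (Finset.mem_range.1 hi), Nat.cast_zero, zero_div, zero_mul, mul_zero, ENNReal.ofReal_zero]
  have hshift : ∑' n : ℕ, g n j = ∑' m : ℕ, g (m + j) j := by
    rw [← Summable.sum_add_tsum_nat_add' (f := fun n => g n j) (k := j) ENNReal.summable, Finset.sum_eq_zero hzero, zero_add]
  rw [hshift]
  -- step 3: factor `ofReal (p_j)` and resum the weights
  have h3 : ∀ m : ℕ, g (m + j) j = ENNReal.ofReal (simpleStep G j v v) *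
      ENNReal.ofReal ((((m + j + r).choose r : ℕ) : ℝ) * (((m + j).choose j : ℕ) : ℝ) / 2 ^ (m + j)) := by
    intro m
    rw [hg, ← ENNReal.ofReal_mul (hp0 j)]
    ring_nf
  rw [tsum_congr h3, ENNReal.tsum_mul_left]
  obtain ⟨hws, hw⟩ := tsum_weight_eq r j
  rw [← ENNReal.ofReal_tsum_of_nonneg (fun m => by positivity) hws, hw, ← ENNReal.ofReal_mul (hp0 j), ← ENNReal.ofReal_mul (by positivity)]
  congr 1
  ring

/-- **The lazy polygon is controlled by any bound on the simple walk's return probabilities**: if `p_j(v, v) ≤ b_j` for all `j`, then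
`rwPolygon (r+1) G v ≤ ofReal(2^{r+1}) · Σ'_j ofReal(C(j+r, j)·b_j)`. [cite: HeydenreichVanDerHofstad2017, §5.2 (random-walk diagrams)] -/
theorem rwPolygon_succ_le_of_simpleStep_le {V : Type} (G : SimpleGraph V) [G.LocallyFinite] (v : V) (r : ℕ) {b : ℕ → ℝ}
    (h : ∀ j : ℕ, simpleStep G j v v ≤ b j) :
    rwPolygon (r + 1) G v ≤ ENNReal.ofReal (2 ^ (r + 1)) * ∑' j : ℕ, ENNReal.ofReal ((((j + r).choose j : ℕ) : ℝ) * b j) := by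
  rw [rwPolygon_succ_eq]
  gcongr with j
  exact h j

/-! ## §3 Summability of `C(j+r, j)·exp(−c·j^γ)` -/

/-- **`j ↦ C(j+r, j)·exp(−c·j^γ)` is summable** for `c, γ > 0` (a polynomial times a stretched exponential: `u^s = o(e^{cu})` in `u = j^γ`, so eventually
`C(j+r, j)·e^{−c j^γ} ≤ (r+1)^r·j^r·j^{−(r+2)} = (r+1)^r/j²`). [folklore] -/
theorem summable_choose_mul_exp_neg_rpow (r : ℕ) {c γ : ℝ} (hc : 0 < c) (hγ : 0 < γ) :
    Summable fun j : ℕ => (((j + r).choose j : ℕ) : ℝ) * Real.exp (-(c * (j : ℝ) ^ γ)) := by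
  -- eventually in `u`: `u^{(r+2)/γ} ≤ exp(c u)`
  have hlo := isLittleO_rpow_exp_pos_mul_atTop (((r : ℝ) + 2) / γ) hc
  have hev : ∀ᶠ u : ℝ in atTop, u ^ (((r : ℝ) + 2) / γ) ≤ Real.exp (c * u) := by
    filter_upwards [hlo.def one_pos, eventually_ge_atTop (0 : ℝ)] with u hu hu0
    rw [one_mul, Real.norm_of_nonneg (Real.rpow_nonneg hu0 _), Real.norm_of_nonneg (Real.exp_pos _).le] at hu
    exact hu
  obtain ⟨u₀, hu₀⟩ := Filter.eventually_atTop.1 hev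
  -- comparison series `(r+1)^r / j^2`
  have hcmp : Summable fun j : ℕ => ((r : ℝ) + 1) ^ r * ((j : ℝ) ^ 2)⁻¹ :=
    (Real.summable_nat_pow_inv.2 one_lt_two).mul_left _
  refine Summable.of_norm_bounded_eventually_nat hcmp ?_
  filter_upwards [Filter.eventually_ge_atTop (max 1 ⌈(max u₀ 0) ^ γ⁻¹⌉₊)] with j hj
  have hj1 : 1 ≤ j := le_trans (le_max_left _ _) hj
  have hjr : (1 : ℝ) ≤ (j : ℝ) := by exact_mod_cast hj1
  have hjpos : (0 : ℝ) < (j : ℝ) := by linarith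
  -- `u₀ ≤ j^γ`
  have hu : u₀ ≤ (j : ℝ) ^ γ := by
    have h1 : (max u₀ 0) ^ γ⁻¹ ≤ (j : ℝ) := by
      have := Nat.le_ceil ((max u₀ 0) ^ γ⁻¹)
      have h2 : (⌈(max u₀ 0) ^ γ⁻¹⌉₊ : ℝ) ≤ (j : ℝ) := by exact_mod_cast le_trans (le_max_right _ _) hj
      linarith
    have h3 := Real.rpow_le_rpow (Real.rpow_nonneg (le_max_right _ _) _) h1 hγ.le
    rw [Real.rpow_inv_rpow (le_max_right _ _) hγ.ne'] at h3
    exact (le_max_left _ _).trans h3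
  -- `j^{r+2} ≤ exp(c j^γ)`
  have hpow : (j : ℝ) ^ (r + 2) ≤ Real.exp (c * (j : ℝ) ^ γ) := by
    have h := hu₀ _ hu
    rw [← Real.rpow_mul hjpos.le, show γ * (((r : ℝ) + 2) / γ) = ((r + 2 : ℕ) : ℝ) by push_cast; field_simp, Real.rpow_natCast] at h
    exact h
  -- `C(j+r, j) ≤ (j+r)^r ≤ ((r+1) j)^r`
  have hchoose : (((j + r).choose j : ℕ) : ℝ) ≤ (((r : ℝ) + 1) * (j : ℝ)) ^ r := by
    have h1 : (j + r).choose j ≤ (j + r) ^ r := by rw [Nat.choose_symm_add]; exact Nat.choose_le_pow _ _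
    have h2 : (((j + r).choose j : ℕ) : ℝ) ≤ ((j : ℝ) + r) ^ r := by exact_mod_cast h1
    refine h2.trans (pow_le_pow_left₀ (by positivity) ?_ r)
    nlinarith
  -- assemble
  rw [Real.norm_of_nonneg (by positivity)]
  have hexp : Real.exp (-(c * (j : ℝ) ^ γ)) ≤ ((j : ℝ) ^ (r + 2))⁻¹ := by
    rw [Real.exp_neg]
    exact inv_anti₀ (by positivity) hpow
  calc (((j + r).choose j : ℕ) : ℝ) * Real.exp (-(c * (j : ℝ) ^ γ))
      ≤ (((r : ℝ) + 1) * (j : ℝ)) ^ r * ((j : ℝ) ^ (r + 2))⁻¹ :=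
        mul_le_mul hchoose hexp (Real.exp_pos _).le (by positivity)
    _ = ((r : ℝ) + 1) ^ r * ((j : ℝ) ^ 2)⁻¹ := by
        rw [mul_pow, pow_add]; field_simp

/-! ## §4 The stub: uniform polygons, modulo Woess -/

/-- **`UniformPolygons q` for EVERY `q`, modulo Woess 2000 Cor. 14.5(b)** — W4 stub `stub_uniformPolygons` DISCHARGED in the binder reading `∀ q, UniformPolygons q`
(p3 g42 b1): the lazy random-walk `q`-gons of `Cay(𝔊^k; std)` are bounded UNIFORMLY in `k ≥ 1` and in the vertex, with the explicit `k`-free bound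
`ofReal(2^{r+1})·ofReal(Σ_j C(j+r, j)·e^{−c j^γ})` (`q = r+1`; `q = 0` reads as `q = 1`), from FILE a's `k`-uniform return decay `p^{(k)}_j(v,v) ≤ e^{−c j^γ}`
(Woess ONCE on the base `Cay(𝔊)`, transfer through the walk product formula) and §§1–3.  CONDITIONAL on the printed named fact `hW` ONLY; nothing about `θ(p_c)`,
OIRB or the triangle condition on any `Cay(𝔊^k)`; `gkCay_conj4 k` OPEN. [cite: Woess2000, Cor. 14.5(b), Thm. 4.18] [cite: HeydenreichVanDerHofstad2017, §5.2 (random-walk diagrams)] -/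
theorem uniformPolygons_of_woess (hW : Woess2000_closedWalks_decay_of_growth) (q : ℕ) : UniformPolygons q := by
  obtain ⟨c, γ, hc, hγ, -, hp⟩ := simpleStep_gkCay_self_le_exp hW
  -- reduce to `q = r + 1`
  obtain ⟨r, hr⟩ : ∃ r : ℕ, ∀ (k : ℕ) (v : GPow k), rwPolygon q (gkCay k) v = rwPolygon (r + 1) (gkCay k) v := by
    rcases Nat.eq_zero_or_pos q with rfl | hq
    · exact ⟨0, fun k v => rwPolygon_zero_eq_one _ _⟩
    · exact ⟨q - 1, fun k v => by rw [Nat.sub_add_cancel hq]⟩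
  have hsum := summable_choose_mul_exp_neg_rpow r hc hγ
  refine ⟨ENNReal.ofReal (2 ^ (r + 1)) * ENNReal.ofReal (∑' j : ℕ, (((j + r).choose j : ℕ) : ℝ) * Real.exp (-(c * (j : ℝ) ^ γ))),
    ENNReal.mul_lt_top ENNReal.ofReal_lt_top ENNReal.ofReal_lt_top, fun k hk v => ?_⟩
  rw [hr k v, ENNReal.ofReal_tsum_of_nonneg (fun j => by positivity) hsum]
  exact rwPolygon_succ_le_of_simpleStep_le (gkCay k) v r (hp k hk v)

end NcHaraSlade

end Grigorchuk

end Summit.CriticalPhenomena.PercolationContinuityZ3.Theorems.Transplant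

end
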